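import Summits.AtomisticToContinuum.HydrodynamicLimit.Theses.MourreKoopmanCharges
import Literature.MathematicalPhysics.KineticTheory.HardSphereTwoTimePressure
import Literature.Analysis.FluidPDE.HardSphereUniqueness
import HarnessLib

/-!
# `StressStrongMixing` · line `birth`: the crux's torus moment does not depend on the flow family

Support file for the crux item stmt-AtomisticToContinuum-9584 (`StressStrongMixing`, route `MourreKoopmanCharges` of
`AtomisticToContinuum/HydrodynamicLimit`), line `birth` (`Cruxes/StressStrongMixing/Lines/birth.lean`).  The crux
quantifies over EVERY family `Φ N` of hard-sphere flows of `N + 1` spheres of diameter `σ(N+1)^{-1/3}` on `𝕋³`; this is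
innocuous: two hard-sphere flows agree Liouville-almost everywhere at every time
(`HardSphereFlow.flow_eq_ae_holds`, GST 2013 Prop. 4.1.1, PROVED in the tree), the canonical Gibbs law
`G_N = localGibbsLaw σ 1 0 θ N (Φ N)` is absolutely continuous with respect to the Liouville measure and does not
depend on the flow argument (`localGibbsLaw_eq`), hence the crux's two-time moment
`M_N(s) = (N+1)·E_{G_N}[Π(χ₁)(Φ_{s(N+1)^{-1/3}} z)·Π(χ₂)(z)]` is the same number for all flow families
(`torusStressMoment_flow_independent`), for every `σ, θ, χ₁, χ₂, s, N` (no hypotheses at all).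

References: I. Gallagher, L. Saint-Raymond, B. Texier, *From Newton to Boltzmann* (2013), Prop. 4.1.1.
-/

noncomputable section

open MeasureTheory ProbabilityTheory Filter Topology
open scoped InnerProductSpace ENNReal

namespace Summit.AtomisticToContinuum.HydrodynamicLimit.Theorems.MourreKoopmanChargesStressStrongMixing

open Literature.MathematicalPhysics.KineticTheory Literature.Analysis.FluidPDE

/-- **Two hard-sphere flows agree almost surely under the canonical Gibbs law** (every profile): `G_N ≪ Liouville`
(`localGibbsLaw_absolutelyContinuous`) and `HardSphereFlow.flow_eq_ae_holds`. [folklore] -/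
theorem flow_ae_eq_flow_localGibbsLaw (σ : ℝ) (a₀ : T3 → ℝ) (u₀ : T3 → V3) (θ₀ : T3 → ℝ) (N : ℕ)
    (Φ Ψ : HardSphereFlow (Torus.geometry (Fin 3)) (hsDiameter σ N) (N + 1)) (t : ℝ) :
    Φ.flow t =ᵐ[localGibbsLaw σ a₀ u₀ θ₀ N Φ] Ψ.flow t :=
  (localGibbsLaw_absolutelyContinuous σ a₀ u₀ θ₀ N Φ).ae_le (HardSphereFlow.flow_eq_ae_holds Φ Ψ t)

/-- **The canonical Gibbs law does not depend on its flow argument** (it only fixes the phase space):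
`localGibbsLaw σ a₀ u₀ θ₀ N Φ = localGibbsLaw σ a₀ u₀ θ₀ N Ψ`. [folklore] -/
theorem localGibbsLaw_flow_independent (σ : ℝ) (a₀ : T3 → ℝ) (u₀ : T3 → V3) (θ₀ : T3 → ℝ) (N : ℕ)
    (Φ Ψ : HardSphereFlow (Torus.geometry (Fin 3)) (hsDiameter σ N) (N + 1)) :
    localGibbsLaw σ a₀ u₀ θ₀ N Φ = localGibbsLaw σ a₀ u₀ θ₀ N Ψ := by
  rw [localGibbsLaw_eq, localGibbsLaw_eq]

/-- **The crux's torus two-time stress moment does not depend on the flow family**: for all `σ, θ`, flow families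
`Φ, Ψ`, test functions `χ₁, χ₂`, times `s` and sizes `N`,
`(N+1)·E_{G_N(Φ)}[Π(χ₁)((Φ N)_{s(N+1)^{-1/3}} z)·Π(χ₂)(z)] = (N+1)·E_{G_N(Ψ)}[Π(χ₁)((Ψ N)_{s(N+1)^{-1/3}} z)·Π(χ₂)(z)]`
— the two flows agree `G_N`-a.e. (`flow_ae_eq_flow_localGibbsLaw`) and the two laws coincide
(`localGibbsLaw_flow_independent`). [folklore] -/
theorem torusStressMoment_flow_independent :
    ∀ (σ θ : ℝ) (Φ Ψ : (N : ℕ) → HardSphereFlow (Torus.geometry (Fin 3)) (hsDiameter σ N) (N + 1))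
      (χ₁ χ₂ : T3 → ℝ) (s : ℝ) (N : ℕ),
      ((N : ℝ) + 1) * ∫ z, (∫ y, χ₁ y.1 * (y.2 0 * y.2 1)
          ∂(empiricalMeasure ((Φ N).flow (s * ((N : ℝ) + 1) ^ (-(1 / 3 : ℝ))) z))) *
        (∫ y, χ₂ y.1 * (y.2 0 * y.2 1) ∂(empiricalMeasure z))
        ∂(localGibbsLaw σ (fun _ => 1) (fun _ => 0) (fun _ => θ) N (Φ N)) =
      ((N : ℝ) + 1) * ∫ z, (∫ y, χ₁ y.1 * (y.2 0 * y.2 1)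
          ∂(empiricalMeasure ((Ψ N).flow (s * ((N : ℝ) + 1) ^ (-(1 / 3 : ℝ))) z))) *
        (∫ y, χ₂ y.1 * (y.2 0 * y.2 1) ∂(empiricalMeasure z))
        ∂(localGibbsLaw σ (fun _ => 1) (fun _ => 0) (fun _ => θ) N (Ψ N)) := by
  intro σ θ Φ Ψ χ₁ χ₂ s N
  rw [localGibbsLaw_flow_independent σ (fun _ => 1) (fun _ => 0) (fun _ => θ) N (Ψ N) (Φ N)]
  congr 1
  refine integral_congr_ae ?_
  filter_upwards [flow_ae_eq_flow_localGibbsLaw σ (fun _ => 1) (fun _ => 0) (fun _ => θ) N (Φ N) (Ψ N)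
    (s * ((N : ℝ) + 1) ^ (-(1 / 3 : ℝ)))] with z hz
  rw [hz]

end Summit.AtomisticToContinuum.HydrodynamicLimit.Theorems.MourreKoopmanChargesStressStrongMixing

end
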